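import Literature.Probability.Distributions.BrascampLiebCutoff
import Literature.Probability.Distributions.BrascampLiebMatrix
import HarnessLib

/-!
# The modified potentials `f_N = χ f + N ψ_S` of the Brascamp–Lieb approximation are tame

`Literature/Probability/Distributions/`. Last step of the proof of Brascamp–Lieb 1976, Theorem 4.1
(p. 379): outside a ball the potential is modified so that the induction (which we run for TAME
data only, `BrascampLiebInduction.core`) applies, and then `N → ∞`. Here, for a general
`f ∈ C²(ℝᵐ)` with positive definite Hessian, a cutoff `χ ∈ C²_c` with `0 ≤ χ`, `χ = 1` near the
cube `‖x‖_∞ < S + 1`, and the confining potential `ψ_S` of `BrascampLiebCutoff`: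

* generic bounds for compactly supported `C²`/`C¹` functions;
* `f_N = χ f + N ψ_S` is `C²`, linearly coercive, with polynomially bounded first and second
  derivatives, and — for `N` large — with positive definite Hessian everywhere
  (`posDef_coordHessian_modified`); the second derivative of `χ f` along a line is
  `χ'' f + 2 χ' f' + χ f''`;
* comparison of Hessians: `f_xx ≤ (f_N)_xx` where `χ = 1`, with equality on the ball
  `{∑ xᵢ² ≤ S²}`.

Theorems only. References: H. J. Brascamp, E. H. Lieb, J. Funct. Anal. 22 (1976) 366–389,
Thm 4.1 (proof, p. 379). [BrascampLieb1976]
-/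

noncomputable section

open Filter Set Metric Finset Matrix
open scoped Topology BigOperators

namespace Literature.Probability.Distributions

namespace BrascampLiebModified

open BrascampLiebCalculus BrascampLiebCutoff BrascampLiebMatrix

variable {m : ℕ}

/-! ### Compactly supported functions are tame with exponent `0` -/

/-- The second derivative of a compactly supported `C²` function is bounded (via the entries of
its Hessian matrix, which are continuous with compact support). [folklore] -/
theorem fderiv_fderiv_bound_of_hasCompactSupport {u : (Fin m → ℝ) → ℝ} (hu : ContDiff ℝ 2 u)
    (hs : HasCompactSupport u) :
    ∃ K : ℝ, 0 ≤ K ∧ ∀ x v w, |fderiv ℝ (fun x' => fderiv ℝ u x' v) x w| ≤ K * ‖v‖ * ‖w‖ := by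
  have hent : ∀ i j : Fin m, ∃ B : ℝ, ∀ x, |coordHessian u x i j| ≤ B := by
    intro i j
    have hc : Continuous fun x => coordHessian u x i j := (continuous_coordHessian hu).matrix_elem i j
    have hcs : HasCompactSupport fun x => coordHessian u x i j := by
      refine HasCompactSupport.intro hs fun x hx => ?_
      have h0 : u =ᶠ[𝓝 x] fun _ => 0 := notMem_tsupport_iff_eventuallyEq.1 hx
      have h1 : (fun y => fderiv ℝ u y (Pi.single j 1)) =ᶠ[𝓝 x] fun _ => 0 := by
        filter_upwards [h0.fderiv (𝕜 := ℝ)] with y hy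
        rw [hy]; simp
      simp only [coordHessian, Matrix.of_apply]
      rw [h1.fderiv_eq]; simp
    obtain ⟨B, hB⟩ := hcs.exists_bound_of_continuous hc
    exact ⟨B, fun x => by simpa [Real.norm_eq_abs] using hB x⟩
  choose B hB using hent
  refine ⟨∑ i, ∑ j, |B i j|, by positivity, fun x v w => ?_⟩
  rw [(hasFDerivAt_fderiv_apply hu x v).fderiv, ContinuousLinearMap.flip_apply,
    ← dotProduct_coordHessian_mulVec hu x w v]
  simp only [dotProduct, mulVec]
  calc |∑ i, w i * ∑ j, coordHessian u x i j * v j|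
      ≤ ∑ i, |w i * ∑ j, coordHessian u x i j * v j| := abs_sum_le_sum_abs _ _
    _ ≤ ∑ i, ‖w‖ * ∑ j, |B i j| * ‖v‖ := by
        refine sum_le_sum fun i _ => ?_
        rw [abs_mul]
        refine mul_le_mul ?_ ?_ (abs_nonneg _) (norm_nonneg _)
        · simpa using norm_le_pi_norm w i
        · refine (abs_sum_le_sum_abs _ _).trans (sum_le_sum fun j _ => ?_)
          rw [abs_mul]
          refine mul_le_mul ((hB i j x).trans (le_abs_self _)) ?_ (abs_nonneg _) (abs_nonneg _)
          simpa using norm_le_pi_norm v j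
    _ = (∑ i, ∑ j, |B i j|) * ‖v‖ * ‖w‖ := by
        simp only [Finset.mul_sum, Finset.sum_mul]
        exact Finset.sum_congr rfl fun i _ => Finset.sum_congr rfl fun j _ => by ring

/-- A compactly supported `C²` function is bounded with bounded first and second derivatives.
[folklore] -/
theorem bounds_of_hasCompactSupport {u : (Fin m → ℝ) → ℝ} (hu : ContDiff ℝ 2 u)
    (hs : HasCompactSupport u) :
    ∃ K : ℝ, 0 ≤ K ∧ (∀ x, |u x| ≤ K) ∧ (∀ x v, |fderiv ℝ u x v| ≤ K * ‖v‖) ∧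
      (∀ x v w, |fderiv ℝ (fun x' => fderiv ℝ u x' v) x w| ≤ K * ‖v‖ * ‖w‖) := by
  obtain ⟨C₀, hC₀⟩ := hs.exists_bound_of_continuous hu.continuous
  obtain ⟨C₁, hC₁⟩ := (hs.fderiv (𝕜 := ℝ)).exists_bound_of_continuous (hu.continuous_fderiv two_ne_zero)
  obtain ⟨C₂, hC₂0, hC₂⟩ := fderiv_fderiv_bound_of_hasCompactSupport hu hs
  refine ⟨|C₀| + |C₁| + C₂, by positivity, fun x => ?_, fun x v => ?_, fun x v w => ?_⟩
  · have := hC₀ x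
    rw [Real.norm_eq_abs] at this
    linarith [abs_nonneg C₁, le_abs_self C₀]
  · have h1 : |fderiv ℝ u x v| ≤ ‖fderiv ℝ u x‖ * ‖v‖ := by
      rw [← Real.norm_eq_abs]; exact ContinuousLinearMap.le_opNorm _ _
    have h2 : ‖fderiv ℝ u x‖ ≤ |C₀| + |C₁| + C₂ := by
      linarith [hC₁ x, abs_nonneg C₀, le_abs_self C₁]
    exact h1.trans (mul_le_mul_of_nonneg_right h2 (norm_nonneg _))
  · refine (hC₂ x v w).trans ?_
    have : C₂ ≤ |C₀| + |C₁| + C₂ := by linarith [abs_nonneg C₀, abs_nonneg C₁]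
    have hv := norm_nonneg v
    have hw := norm_nonneg w
    gcongr

/-- A compactly supported `C¹` function is bounded with bounded derivative. [folklore] -/
theorem bounds_of_hasCompactSupport' {u : (Fin m → ℝ) → ℝ} (hu : ContDiff ℝ 1 u)
    (hs : HasCompactSupport u) :
    ∃ K : ℝ, 0 ≤ K ∧ (∀ x, |u x| ≤ K) ∧ (∀ x v, |fderiv ℝ u x v| ≤ K * ‖v‖) := by
  obtain ⟨C₀, hC₀⟩ := hs.exists_bound_of_continuous hu.continuous
  obtain ⟨C₁, hC₁⟩ := (hs.fderiv (𝕜 := ℝ)).exists_bound_of_continuous (hu.continuous_fderiv one_ne_zero)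
  refine ⟨|C₀| + |C₁|, by positivity, fun x => ?_, fun x v => ?_⟩
  · have := hC₀ x
    rw [Real.norm_eq_abs] at this
    linarith [abs_nonneg C₁, le_abs_self C₀]
  · have h1 : |fderiv ℝ u x v| ≤ ‖fderiv ℝ u x‖ * ‖v‖ := by
      rw [← Real.norm_eq_abs]; exact ContinuousLinearMap.le_opNorm _ _
    have h2 : ‖fderiv ℝ u x‖ ≤ |C₀| + |C₁| := by
      linarith [hC₁ x, abs_nonneg C₀, le_abs_self C₁]
    exact h1.trans (mul_le_mul_of_nonneg_right h2 (norm_nonneg _))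

/-! ### Second derivatives of products along lines -/

/-- **`(χ f)'' = χ'' f + 2 χ' f' + χ f''` along a line**, expressed with Fréchet derivatives:
for `C²` functions `a, b` on `ℝᵐ`,
`D(x ↦ D(ab)(x)v)(x) v = D(Da·v)(x)v · b + 2 Da(x)v Db(x)v + a D(Db·v)(x)v`. [folklore] -/
theorem fderiv_fderiv_mul_self {a b : (Fin m → ℝ) → ℝ} (ha : ContDiff ℝ 2 a) (hb : ContDiff ℝ 2 b)
    (x v : Fin m → ℝ) :
    fderiv ℝ (fun x' => fderiv ℝ (fun y => a y * b y) x' v) x v =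
      fderiv ℝ (fun x' => fderiv ℝ a x' v) x v * b x + 2 * (fderiv ℝ a x v * fderiv ℝ b x v) +
        a x * fderiv ℝ (fun x' => fderiv ℝ b x' v) x v := by
  have had : Differentiable ℝ a := ha.differentiable two_ne_zero
  have hbd : Differentiable ℝ b := hb.differentiable two_ne_zero
  have hab : ContDiff ℝ 2 (fun y => a y * b y) := ha.mul hb
  have habd : Differentiable ℝ (fun y => a y * b y) := hab.differentiable two_ne_zero
  -- line functions
  have la : ∀ s, HasDerivAt (fun s : ℝ => a (x + s • v)) (fderiv ℝ a (x + s • v) v) s :=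
    fun s => hasDerivAt_line had x v s
  have lb : ∀ s, HasDerivAt (fun s : ℝ => b (x + s • v)) (fderiv ℝ b (x + s • v) v) s :=
    fun s => hasDerivAt_line hbd x v s
  have la' : ∀ s, HasDerivAt (fun s : ℝ => fderiv ℝ a (x + s • v) v)
      (fderiv ℝ (fderiv ℝ a) (x + s • v) v v) s := fun s => hasDerivAt_line_fderiv ha x v s
  have lb' : ∀ s, HasDerivAt (fun s : ℝ => fderiv ℝ b (x + s • v) v)
      (fderiv ℝ (fderiv ℝ b) (x + s • v) v v) s := fun s => hasDerivAt_line_fderiv hb x v s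
  -- first derivative of the product along the line, two ways
  have e1 : ∀ s : ℝ, fderiv ℝ (fun y => a y * b y) (x + s • v) v =
      fderiv ℝ a (x + s • v) v * b (x + s • v) + a (x + s • v) * fderiv ℝ b (x + s • v) v := by
    intro s
    exact (hasDerivAt_line habd x v s).unique ((la s).mul (lb s))
  -- second derivative along the line
  have h2 := hasDerivAt_line_fderiv hab x v 0
  have e2 : (fun s : ℝ => fderiv ℝ (fun y => a y * b y) (x + s • v) v) =
      fun s => fderiv ℝ a (x + s • v) v * b (x + s • v) + a (x + s • v) * fderiv ℝ b (x + s • v) v :=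
    funext e1
  rw [e2] at h2
  have h3 := ((la' 0).mul (lb 0)).add ((la 0).mul (lb' 0))
  have key := h2.unique h3
  simp only [zero_smul, add_zero] at key
  rw [(hasFDerivAt_fderiv_apply hab x v).fderiv, ContinuousLinearMap.flip_apply, key,
    (hasFDerivAt_fderiv_apply ha x v).fderiv, (hasFDerivAt_fderiv_apply hb x v).fderiv,
    ContinuousLinearMap.flip_apply, ContinuousLinearMap.flip_apply]
  ring

/-! ### The modified potential -/

section Modified

variable {f χ : (Fin m → ℝ) → ℝ} {S N : ℝ}

/-- `f_N = χ f + N ψ_S` is `C²`. [folklore] -/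
theorem contDiff_modified (hf : ContDiff ℝ 2 f) (hχ : ContDiff ℝ 2 χ) (S N : ℝ) :
    ContDiff ℝ 2 (fun x : Fin m → ℝ => χ x * f x + N * max ((∑ i, x i ^ 2) - S ^ 2) 0 ^ 3) :=
  (hχ.mul hf).add (contDiff_const.mul (contDiff_psi S))

/-- First derivative of `f_N`. [folklore] -/
theorem fderiv_modified_apply (hf : ContDiff ℝ 2 f) (hχ : ContDiff ℝ 2 χ) (S N : ℝ) (x v : Fin m → ℝ) :
    fderiv ℝ (fun x : Fin m → ℝ => χ x * f x + N * max ((∑ i, x i ^ 2) - S ^ 2) 0 ^ 3) x v =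
      fderiv ℝ (fun y => χ y * f y) x v +
        N * fderiv ℝ (fun x : Fin m → ℝ => max ((∑ i, x i ^ 2) - S ^ 2) 0 ^ 3) x v := by
  have h1 : DifferentiableAt ℝ (fun y => χ y * f y) x :=
    ((hχ.mul hf).differentiable two_ne_zero) x
  have h2 : DifferentiableAt ℝ (fun x : Fin m → ℝ => max ((∑ i, x i ^ 2) - S ^ 2) 0 ^ 3) x :=
    ((contDiff_psi S).differentiable two_ne_zero) x
  have e : fderiv ℝ (fun x : Fin m → ℝ => χ x * f x + N * max ((∑ i, x i ^ 2) - S ^ 2) 0 ^ 3) x =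
      fderiv ℝ (fun y => χ y * f y) x +
        N • fderiv ℝ (fun x : Fin m → ℝ => max ((∑ i, x i ^ 2) - S ^ 2) 0 ^ 3) x :=
    (h1.hasFDerivAt.add (h2.hasFDerivAt.const_mul N)).fderiv
  rw [e]
  rfl

/-- Second derivative of `f_N` (directional, iterated). [folklore] -/
theorem fderiv_fderiv_modified_apply (hf : ContDiff ℝ 2 f) (hχ : ContDiff ℝ 2 χ) (S N : ℝ)
    (x v w : Fin m → ℝ) :
    fderiv ℝ (fun x' => fderiv ℝ
        (fun x : Fin m → ℝ => χ x * f x + N * max ((∑ i, x i ^ 2) - S ^ 2) 0 ^ 3) x' v) x w =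
      fderiv ℝ (fun x' => fderiv ℝ (fun y => χ y * f y) x' v) x w +
        N * fderiv ℝ (fun x' => fderiv ℝ (fun x : Fin m → ℝ => max ((∑ i, x i ^ 2) - S ^ 2) 0 ^ 3) x' v) x w := by
  have e : (fun x' => fderiv ℝ
      (fun x : Fin m → ℝ => χ x * f x + N * max ((∑ i, x i ^ 2) - S ^ 2) 0 ^ 3) x' v) =
      fun x' => fderiv ℝ (fun y => χ y * f y) x' v +
        N * fderiv ℝ (fun x : Fin m → ℝ => max ((∑ i, x i ^ 2) - S ^ 2) 0 ^ 3) x' v :=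
    funext fun x' => fderiv_modified_apply hf hχ S N x' v
  rw [e]
  have h1 : DifferentiableAt ℝ (fun x' => fderiv ℝ (fun y => χ y * f y) x' v) x :=
    (hasFDerivAt_fderiv_apply (hχ.mul hf) x v).differentiableAt
  have h2 : DifferentiableAt ℝ (fun x' => fderiv ℝ
      (fun x : Fin m → ℝ => max ((∑ i, x i ^ 2) - S ^ 2) 0 ^ 3) x' v) x :=
    (hasFDerivAt_fderiv_apply (contDiff_psi S) x v).differentiableAt
  have e2 : fderiv ℝ (fun x' => fderiv ℝ (fun y => χ y * f y) x' v +
        N * fderiv ℝ (fun x : Fin m → ℝ => max ((∑ i, x i ^ 2) - S ^ 2) 0 ^ 3) x' v) x =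
      fderiv ℝ (fun x' => fderiv ℝ (fun y => χ y * f y) x' v) x +
        N • fderiv ℝ (fun x' => fderiv ℝ (fun x : Fin m → ℝ => max ((∑ i, x i ^ 2) - S ^ 2) 0 ^ 3) x' v) x :=
    (h1.hasFDerivAt.add (h2.hasFDerivAt.const_mul N)).fderiv
  rw [e2]
  rfl

/-- **`f_N` has polynomially bounded first and second derivatives and is linearly coercive**
(for `N ≥ 1`, `S ≥ 0`): with `K_u` the bound of `χ f` and its two derivatives,
`|Df_N(x)v| , |D(Df_N·v)(x)w|/‖w‖ ≤ (K_u + 30 N m³)(1+‖x‖)⁵‖v‖` and `f_N x ≥ ‖x‖ - (K_u + S² + S + 1)`.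
[cite: BrascampLieb1976, Thm 4.1 (proof, p. 379)] -/
theorem tame_modified (hf : ContDiff ℝ 2 f) (hχ : ContDiff ℝ 2 χ) (hχs : HasCompactSupport χ)
    (hS : 0 ≤ S) (hN : 1 ≤ N) :
    ∃ K : ℝ, 0 ≤ K ∧ ∃ C₀ : ℝ,
      (∀ x, 1 * ‖x‖ - C₀ ≤ χ x * f x + N * max ((∑ i, x i ^ 2) - S ^ 2) 0 ^ 3) ∧
      (∀ x v, |fderiv ℝ (fun x : Fin m → ℝ => χ x * f x + N * max ((∑ i, x i ^ 2) - S ^ 2) 0 ^ 3) x v| ≤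
        K * (1 + ‖x‖) ^ 5 * ‖v‖) ∧
      (∀ x v w, |fderiv ℝ (fun x' => fderiv ℝ
          (fun x : Fin m → ℝ => χ x * f x + N * max ((∑ i, x i ^ 2) - S ^ 2) 0 ^ 3) x' v) x w| ≤
        K * (1 + ‖x‖) ^ 5 * ‖v‖ * ‖w‖) := by
  have hu : ContDiff ℝ 2 (fun y => χ y * f y) := hχ.mul hf
  have hus : HasCompactSupport (fun y => χ y * f y) := hχs.mul_right
  obtain ⟨Ku, hKu0, hu0, hu1, hu2⟩ := bounds_of_hasCompactSupport hu hus
  have hN0 : 0 ≤ N := zero_le_one.trans hN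
  refine ⟨Ku + 30 * N * (m : ℝ) ^ 3, by positivity, Ku + (S ^ 2 + S + 1), fun x => ?_, fun x v => ?_,
    fun x v w => ?_⟩
  · have h1 := hu0 x
    have h2 := psi_ge S hS x
    have h3 := psi_nonneg S x
    have : max ((∑ i, x i ^ 2) - S ^ 2) 0 ^ 3 ≤ N * max ((∑ i, x i ^ 2) - S ^ 2) 0 ^ 3 :=
      le_mul_of_one_le_left h3 hN
    have h4 := neg_abs_le (χ x * f x)
    linarith
  · rw [fderiv_modified_apply hf hχ]
    have h1 := hu1 x v
    have h2 := fderiv_psi_bound S x v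
    have hx : (1 : ℝ) ≤ (1 + ‖x‖) ^ 5 := one_le_pow₀ (by linarith [norm_nonneg x])
    have hv := norm_nonneg v
    calc |fderiv ℝ (fun y => χ y * f y) x v +
          N * fderiv ℝ (fun x : Fin m → ℝ => max ((∑ i, x i ^ 2) - S ^ 2) 0 ^ 3) x v|
        ≤ |fderiv ℝ (fun y => χ y * f y) x v| +
          |N * fderiv ℝ (fun x : Fin m → ℝ => max ((∑ i, x i ^ 2) - S ^ 2) 0 ^ 3) x v| := abs_add_le _ _
      _ ≤ Ku * ‖v‖ + N * (6 * (m : ℝ) ^ 3 * (1 + ‖x‖) ^ 5 * ‖v‖) := by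
          rw [abs_mul, abs_of_nonneg hN0]
          gcongr
      _ ≤ Ku * ((1 + ‖x‖) ^ 5 * ‖v‖) + N * (30 * (m : ℝ) ^ 3 * (1 + ‖x‖) ^ 5 * ‖v‖) := by
          gcongr
          · nlinarith
          · norm_num
      _ = (Ku + 30 * N * (m : ℝ) ^ 3) * (1 + ‖x‖) ^ 5 * ‖v‖ := by ring
  · rw [fderiv_fderiv_modified_apply hf hχ]
    have h1 := hu2 x v w
    have h2 := fderiv_fderiv_psi_bound S x v w
    have hx : (1 : ℝ) ≤ (1 + ‖x‖) ^ 5 := one_le_pow₀ (by linarith [norm_nonneg x])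
    have hv := norm_nonneg v
    have hw := norm_nonneg w
    calc |fderiv ℝ (fun x' => fderiv ℝ (fun y => χ y * f y) x' v) x w +
          N * fderiv ℝ (fun x' => fderiv ℝ
            (fun x : Fin m → ℝ => max ((∑ i, x i ^ 2) - S ^ 2) 0 ^ 3) x' v) x w|
        ≤ |fderiv ℝ (fun x' => fderiv ℝ (fun y => χ y * f y) x' v) x w| +
          |N * fderiv ℝ (fun x' => fderiv ℝ
            (fun x : Fin m → ℝ => max ((∑ i, x i ^ 2) - S ^ 2) 0 ^ 3) x' v) x w| := abs_add_le _ _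
      _ ≤ Ku * ‖v‖ * ‖w‖ + N * (30 * (m : ℝ) ^ 3 * (1 + ‖x‖) ^ 5 * ‖v‖ * ‖w‖) := by
          rw [abs_mul, abs_of_nonneg hN0]
          gcongr
      _ ≤ Ku * ((1 + ‖x‖) ^ 5 * ‖v‖) * ‖w‖ + N * (30 * (m : ℝ) ^ 3 * (1 + ‖x‖) ^ 5 * ‖v‖ * ‖w‖) := by
          gcongr
          nlinarith
      _ = (Ku + 30 * N * (m : ℝ) ^ 3) * (1 + ‖x‖) ^ 5 * ‖v‖ * ‖w‖ := by ring

/-- **Positive definiteness of the modified Hessian for large `N`.** If `f_xx > 0`, `χ ≥ 0` and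
`χ = 1` near the cube `‖x‖_∞ < S + 1`, then for `N ≥ N₀` the Hessian of `f_N = χ f + N ψ_S` is
positive definite everywhere: inside the cube it dominates `f_xx`; outside, the strong convexity
`6N(2S+1)²` of `N ψ_S` beats the bounded error `χ'' f + 2χ' f'`.
[cite: BrascampLieb1976, Thm 4.1 (proof, p. 379)] -/
theorem posDef_coordHessian_modified (hf : ContDiff ℝ 2 f) (hpd : ∀ x, (coordHessian f x).PosDef)
    (hχ : ContDiff ℝ 2 χ) (hχs : HasCompactSupport χ) (hχ0 : ∀ x, 0 ≤ χ x)
    (hχ1 : ∀ x : Fin m → ℝ, ‖x‖ < S + 1 → χ =ᶠ[𝓝 x] fun _ => (1 : ℝ)) (hS : 0 ≤ S) :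
    ∃ N₀ : ℝ, 1 ≤ N₀ ∧ ∀ N, N₀ ≤ N → ∀ x,
      (coordHessian (fun x : Fin m → ℝ => χ x * f x + N * max ((∑ i, x i ^ 2) - S ^ 2) 0 ^ 3) x).PosDef := by
  obtain ⟨Kχ, hKχ0, -, hχb1, hχb2⟩ := bounds_of_hasCompactSupport hχ hχs
  obtain ⟨B₀, hB₀⟩ := hχs.isCompact.exists_bound_of_continuousOn hf.continuous.continuousOn
  obtain ⟨B₁, hB₁⟩ := hχs.isCompact.exists_bound_of_continuousOn
    (hf.continuous_fderiv two_ne_zero).continuousOn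
  set CE : ℝ := Kχ * |B₀| + 2 * Kχ * |B₁| with hCE
  have hCE0 : 0 ≤ CE := by positivity
  have h6 : 0 < 6 * (2 * S + 1) ^ 2 := by positivity
  refine ⟨CE / (6 * (2 * S + 1) ^ 2) + 1, by simp [div_nonneg hCE0 h6.le], fun N hN x => ?_⟩
  have hN0 : 0 ≤ N := by
    have : 0 ≤ CE / (6 * (2 * S + 1) ^ 2) := div_nonneg hCE0 h6.le
    linarith
  have hfN := contDiff_modified hf hχ S N
  rw [posDef_coordHessian_iff hfN]
  intro v hv
  have hvn : 0 < ‖v‖ := norm_pos_iff.2 hv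
  -- `D²f_N(x)(v,v) = U + N Ψ`
  rw [show fderiv ℝ (fderiv ℝ (fun x : Fin m → ℝ => χ x * f x + N * max ((∑ i, x i ^ 2) - S ^ 2) 0 ^ 3)) x v v =
      fderiv ℝ (fun x' => fderiv ℝ
        (fun x : Fin m → ℝ => χ x * f x + N * max ((∑ i, x i ^ 2) - S ^ 2) 0 ^ 3) x' v) x v by
      rw [(hasFDerivAt_fderiv_apply hfN x v).fderiv, ContinuousLinearMap.flip_apply],
    fderiv_fderiv_modified_apply hf hχ]
  have hΨ0 : 0 ≤ fderiv ℝ (fun x' => fderiv ℝ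
      (fun x : Fin m → ℝ => max ((∑ i, x i ^ 2) - S ^ 2) 0 ^ 3) x' v) x v :=
    le_trans (by positivity) (fderiv_fderiv_psi_self_ge S x v)
  have hfvv : 0 < fderiv ℝ (fun x' => fderiv ℝ f x' v) x v := by
    rw [(hasFDerivAt_fderiv_apply hf x v).fderiv, ContinuousLinearMap.flip_apply]
    exact (posDef_coordHessian_iff hf x).1 (hpd x) v hv
  by_cases hx : ‖x‖ < S + 1
  · -- inside the cube `χ = 1` near `x`: `U = D²f(x)(v,v) > 0`
    have he : (fun y => χ y * f y) =ᶠ[𝓝 x] f := by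
      filter_upwards [hχ1 x hx] with y hy
      rw [hy, one_mul]
    have he2 : (fun x' => fderiv ℝ (fun y => χ y * f y) x' v) =ᶠ[𝓝 x] fun x' => fderiv ℝ f x' v := by
      filter_upwards [he.fderiv (𝕜 := ℝ)] with y hy
      rw [hy]
    rw [he2.fderiv_eq]
    nlinarith
  · -- outside: `U ≥ -CE ‖v‖²` and `N Ψ ≥ 6 N (2S+1)² ‖v‖²`
    push Not at hx
    have hΨ := fderiv_fderiv_psi_self_ge_of_norm S hS hx v
    rw [fderiv_fderiv_mul_self hχ hf]
    have hthird : 0 ≤ χ x * fderiv ℝ (fun x' => fderiv ℝ f x' v) x v :=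
      mul_nonneg (hχ0 x) hfvv.le
    have hfirst : -(CE * ‖v‖ ^ 2) ≤
        fderiv ℝ (fun x' => fderiv ℝ χ x' v) x v * f x + 2 * (fderiv ℝ χ x v * fderiv ℝ f x v) := by
      by_cases hxs : x ∈ tsupport χ
      · have b1 : |fderiv ℝ (fun x' => fderiv ℝ χ x' v) x v * f x| ≤ Kχ * ‖v‖ * ‖v‖ * |B₀| := by
          rw [abs_mul]
          refine mul_le_mul (hχb2 x v v) ?_ (abs_nonneg _) (by positivity)
          have := hB₀ x hxs
          rw [Real.norm_eq_abs] at this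
          exact this.trans (le_abs_self _)
        have b2 : |2 * (fderiv ℝ χ x v * fderiv ℝ f x v)| ≤ 2 * (Kχ * ‖v‖ * (|B₁| * ‖v‖)) := by
          rw [abs_mul, abs_two, abs_mul]
          refine mul_le_mul_of_nonneg_left (mul_le_mul (hχb1 x v) ?_ (abs_nonneg _) (by positivity))
            zero_le_two
          have h1 : |fderiv ℝ f x v| ≤ ‖fderiv ℝ f x‖ * ‖v‖ := by
            rw [← Real.norm_eq_abs]; exact ContinuousLinearMap.le_opNorm _ _
          exact h1.trans (mul_le_mul_of_nonneg_right ((hB₁ x hxs).trans (le_abs_self _)) (norm_nonneg _))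
        have e : CE * ‖v‖ ^ 2 = Kχ * ‖v‖ * ‖v‖ * |B₀| + 2 * (Kχ * ‖v‖ * (|B₁| * ‖v‖)) := by
          rw [hCE]; ring
        rw [e]
        have := neg_abs_le (fderiv ℝ (fun x' => fderiv ℝ χ x' v) x v * f x)
        have := neg_abs_le (2 * (fderiv ℝ χ x v * fderiv ℝ f x v))
        linarith
      · -- `χ` vanishes near `x`
        have h0 : χ =ᶠ[𝓝 x] fun _ => 0 := notMem_tsupport_iff_eventuallyEq.1 hxs
        have h1 : fderiv ℝ χ x = 0 := by rw [h0.fderiv_eq]; simp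
        have h2 : (fun x' => fderiv ℝ χ x' v) =ᶠ[𝓝 x] fun _ => 0 := by
          filter_upwards [h0.fderiv (𝕜 := ℝ)] with y hy
          rw [hy]; simp
        have h3 : fderiv ℝ (fun x' => fderiv ℝ χ x' v) x v = 0 := by rw [h2.fderiv_eq]; simp
        rw [h1, h3]
        simp only [zero_mul, _root_.zero_apply, mul_zero, add_zero]
        have : 0 ≤ CE * ‖v‖ ^ 2 := by positivity
        linarith
    have hNΨ : N * (6 * (2 * S + 1) ^ 2 * ‖v‖ ^ 2) ≤
        N * fderiv ℝ (fun x' => fderiv ℝ (fun x : Fin m → ℝ => max ((∑ i, x i ^ 2) - S ^ 2) 0 ^ 3) x' v) x v :=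
      mul_le_mul_of_nonneg_left hΨ hN0
    have hkey : CE * ‖v‖ ^ 2 < N * (6 * (2 * S + 1) ^ 2 * ‖v‖ ^ 2) := by
      have h1 : CE < N * (6 * (2 * S + 1) ^ 2) := by
        have : CE / (6 * (2 * S + 1) ^ 2) * (6 * (2 * S + 1) ^ 2) = CE := div_mul_cancel₀ _ h6.ne'
        nlinarith
      have hv2 : 0 < ‖v‖ ^ 2 := by positivity
      nlinarith
    linarith

/-- **The Hessian of `f_N` inside the cube**: where `χ = 1` near `x`,
`(f_N)_xx(x) = f_xx(x) + N (ψ_S)_xx(x)`. [folklore] -/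
theorem coordHessian_modified_of_norm_lt (hf : ContDiff ℝ 2 f)
    (hχ1 : ∀ x : Fin m → ℝ, ‖x‖ < S + 1 → χ =ᶠ[𝓝 x] fun _ => (1 : ℝ)) (N : ℝ) {x : Fin m → ℝ}
    (hx : ‖x‖ < S + 1) :
    coordHessian (fun x : Fin m → ℝ => χ x * f x + N * max ((∑ i, x i ^ 2) - S ^ 2) 0 ^ 3) x =
      coordHessian f x + N • coordHessian (fun x : Fin m → ℝ => max ((∑ i, x i ^ 2) - S ^ 2) 0 ^ 3) x := by
  -- replace `χ` by `1` near `x`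
  have he : (fun y : Fin m → ℝ => χ y * f y + N * max ((∑ i, y i ^ 2) - S ^ 2) 0 ^ 3) =ᶠ[𝓝 x]
      fun y => (fun _ => (1 : ℝ)) y * f y + N * max ((∑ i, y i ^ 2) - S ^ 2) 0 ^ 3 := by
    filter_upwards [hχ1 x hx] with y hy
    rw [hy]
  have h1 : (fun y : Fin m → ℝ => (fun _ => (1 : ℝ)) y * f y) = f := funext fun y => one_mul _
  ext i j
  simp only [coordHessian, Matrix.of_apply, Matrix.add_apply, Matrix.smul_apply, smul_eq_mul]
  have he2 : (fun y => fderiv ℝ (fun y : Fin m → ℝ => χ y * f y + N * max ((∑ i, y i ^ 2) - S ^ 2) 0 ^ 3) y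
      (Pi.single j 1)) =ᶠ[𝓝 x] fun y => fderiv ℝ
        (fun y : Fin m → ℝ => (fun _ => (1 : ℝ)) y * f y + N * max ((∑ i, y i ^ 2) - S ^ 2) 0 ^ 3) y
        (Pi.single j 1) := by
    filter_upwards [he.fderiv (𝕜 := ℝ)] with y hy
    rw [hy]
  rw [he2.fderiv_eq]
  have := fderiv_fderiv_modified_apply (χ := fun _ => (1 : ℝ)) hf contDiff_const S N x
    (Pi.single j 1) (Pi.single i 1)
  rw [this, h1]

/-- On the Euclidean ball `{∑ xᵢ² ≤ S²}` the Hessians of `f_N` and `f` agree. [folklore] -/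
theorem coordHessian_modified_of_mem_ball (hf : ContDiff ℝ 2 f)
    (hχ1 : ∀ x : Fin m → ℝ, ‖x‖ < S + 1 → χ =ᶠ[𝓝 x] fun _ => (1 : ℝ)) (hS : 0 ≤ S) (N : ℝ)
    {x : Fin m → ℝ} (hx : (∑ i, x i ^ 2) ≤ S ^ 2) :
    coordHessian (fun x : Fin m → ℝ => χ x * f x + N * max ((∑ i, x i ^ 2) - S ^ 2) 0 ^ 3) x =
      coordHessian f x := by
  have hxn : ‖x‖ < S + 1 := by
    have h2 : ‖x‖ ^ 2 ≤ S ^ 2 := (norm_sq_le_sum_sq x).trans hx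
    have h3 : ‖x‖ ≤ S := (pow_le_pow_iff_left₀ (norm_nonneg x) hS two_ne_zero).1 h2
    linarith
  rw [coordHessian_modified_of_norm_lt hf hχ1 N hxn, coordHessian_psi_eq_zero S hx, smul_zero,
    add_zero]

/-- **Hessian comparison inside the cube**: `⟨v, f_xx v⟩ ≤ ⟨v, (f_N)_xx v⟩` where `χ = 1` near
`x` (and `N ≥ 0`), since `(ψ_S)_xx ≥ 0`. [folklore] -/
theorem dotProduct_coordHessian_le_modified (hf : ContDiff ℝ 2 f)
    (hχ1 : ∀ x : Fin m → ℝ, ‖x‖ < S + 1 → χ =ᶠ[𝓝 x] fun _ => (1 : ℝ)) {N : ℝ} (hN : 0 ≤ N)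
    {x : Fin m → ℝ} (hx : ‖x‖ < S + 1) (v : Fin m → ℝ) :
    v ⬝ᵥ (coordHessian f x *ᵥ v) ≤
      v ⬝ᵥ (coordHessian (fun x : Fin m → ℝ => χ x * f x + N * max ((∑ i, x i ^ 2) - S ^ 2) 0 ^ 3) x *ᵥ v) := by
  rw [coordHessian_modified_of_norm_lt hf hχ1 N hx, add_mulVec, dotProduct_add, smul_mulVec,
    dotProduct_smul, smul_eq_mul, dotProduct_coordHessian_mulVec (contDiff_psi S)]
  have := fderiv_fderiv_psi_self_ge S x v
  rw [(hasFDerivAt_fderiv_apply (contDiff_psi S) x v).fderiv, ContinuousLinearMap.flip_apply] at this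
  have h0 : 0 ≤ fderiv ℝ (fderiv ℝ (fun x : Fin m → ℝ => max ((∑ i, x i ^ 2) - S ^ 2) 0 ^ 3)) x v v :=
    le_trans (by positivity) this
  nlinarith

end Modified

end BrascampLiebModified

end Literature.Probability.Distributions
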